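import Mathlib
import Summits.ResolutionOfSingularities.ResolutionOfSingularities.Theorems.RadicialJungCleanModelsCleanProp44CurveSliceNoGamma
import Summits.ResolutionOfSingularities.ResolutionOfSingularities.Theorems.FrobeniusLadderFInjectiveMacaulayficationProp44SliceCurvePlumbing
import HarnessLib

/-!
# Route `RadicialJung`, crux `CleanModels` (stmt-ResolutionOfSingularities-15917), line `Sketch` rev 35, stub 6 `stub_cleanProp44` (X44c):
# the curve-slice cuts LOSE NOTHING — (R3ᵛⁿ′) ⟺ (R3ᵐⁱⁿ) ⟺ (R3ᵐⁱⁿ′) as hypothesis schemas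

Seat decomp-res-hand-2 g17, companion of ✓ `…CleanProp44CurveSliceMinCut.lean` (`curveTauOneVN_of_curveMin` : (R3ᵛⁿ′) ⟸ (R3ᵐⁱⁿ)) and
✓ `…CleanProp44CurveSliceNoGamma.lean` (`curveMin_of_curveMinNoGamma` : (R3ᵐⁱⁿ) ⟸ (R3ᵐⁱⁿ′)).  Here the two remaining directions:

* `curveMin_of_curveTauOneVN` — **(R3ᵐⁱⁿ) ⟸ (R3ᵛⁿ′)**: a `λ`-minimal global curve situation is an instance of the `V`-relative curve slice with
  `V = ⊤` (the regular pair of parameters along the curve by ✓ `CP2008Prop44.exists_rsopPair_of_mem_curve`, a `τ = 1` point ON the curve since the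
  curve contains the whole `m`-stratum; the answer over `⊤` read back by ✓ `exists_isCleanPermissibleSeq_lt_of_top`).
* `curveMinNoGamma_of_curveMin` — **(R3ᵐⁱⁿ′) ⟸ (R3ᵐⁱⁿ)** (drop the inserted hypothesis).

So the hands' curve residual (R3ᵛⁿ′) (g15/g16), its `λ`-minimal form (R3ᵐⁱⁿ) and the «no near curve» form (R3ᵐⁱⁿ′) are KERNEL-EQUIVALENT; together
with ✓ `phaseTwoNCP_of_phaseTwo` / ✓ `phaseTwoMin_of_phaseTwoNCP` / ✓ `phaseTwo_of_phaseTwoMin` on the Phase II side, the eleventh–fourteenth cuts are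
reformulations of the tenth cut's census that only ADD usable hypotheses (minimality, forced insertions, no `Γ′`) to the two research stubs.

Honest framing: OURS; none of the residuals is proved here; nothing here proves X44c, any case of `CleanModels`, or resolution of singularities in
characteristic `p`. [cite: CossartPiltant2008, Prop. 4.4 (proof, pp. 10–11), Lemma 4.3 (4)] [cite: Piltant2013, Prop. 5.1 (proof, Step 2)]
-/

noncomputable section

set_option linter.dupNamespace false -- mandated namespace of this single-conjunct summit

open CategoryTheory CategoryTheory.Limits AlgebraicGeometry TopologicalSpace IsLocalRing
open Literature.AlgebraicGeometry.Resolution Literature.AlgebraicGeometry.Motives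
open Scheme.IdealSheafData
open Summit.ResolutionOfSingularities.ResolutionOfSingularities.Theorems.CP2008Prop44

namespace Summit.ResolutionOfSingularities.ResolutionOfSingularities.Theorems.RadicialJung.CleanModels

/-! ## §1 (R3ᵐⁱⁿ) ⟸ (R3ᵛⁿ′) -/

set_option maxHeartbeats 1600000 in
-- long binder lists
/-- **(R3ᵐⁱⁿ) ⟸ (R3ᵛⁿ′)**: the global `λ`-minimal curve residual is an instance of the `V`-relative clean curve slice (take `V = ⊤`; the
minimality hypothesis is not even used). [cite: CossartPiltant2008, Prop. 4.4 (proof, p. 10)] [cite: Piltant2013, Prop. 5.1 (proof, Step 2)] -/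
theorem curveMin_of_curveTauOneVN
    (hcurveTauOneVN : ∀ (p : ℕ), p.Prime → ∀ {X : Scheme.{0}} [IsIntegral X] [IsNoetherian X], CharP X.functionField p →
      ∀ (hX : Scheme.IsRegular X), Scheme.IsQuasiExcellent X → topologicalKrullDim X ≤ 3 →
      ∀ (G : X.functionField), (∀ x : X, CleanRegAt p (algebraMap (X.presheaf.stalk x) X.functionField) G) →
      ∀ (J : X.IdealSheafData) {m : ℕ}, 1 ≤ m → (∀ z, idealOrder J z ≤ m) → (∀ z ∈ J.support, 1 < Order.coheight z) →
      ∀ (V : X.Opens) (Y : Closeds X), Scheme.IsRegular (vanishingIdeal Y).subscheme → IsIrreducible (Y : Set X) →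
      (Y : Set X) ⊆ (V : Set X) → (∀ z : X, (m : ℕ∞) ≤ idealOrder J z → z ∈ (Y : Set X) ∨ z ∉ (V : Set X)) →
      (∀ y ∈ (Y : Set X), idealOrder J y = m) →
      (∀ y ∈ (Y : Set X), haveI := hX y; ∃ c : Fin 2 → X.presheaf.stalk y, IsRsopPart c ∧
        Ideal.span (Set.range c) = stalkIdeal (vanishingIdeal Y) y) →
      (¬ ∀ y ∈ (Y : Set X), IsClosed ({y} : Set X) → haveI := hX y; 2 ≤ stalkTau J y m) →
      -- (VN′) NOT (clean-permissible at every point of `Y` AND no very near point over `Y` for the blowing ups of `X` along `Y`)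
      (¬ ((∀ y ∈ (Y : Set X), CleanPermissibleAt p (algebraMap (X.presheaf.stalk y) X.functionField) G (stalkIdeal (vanishingIdeal Y) y)) ∧
          (∀ (X₁ : Scheme.{0}) (π : X₁ ⟶ X), IsBlowup π (vanishingIdeal Y) →
            ∀ x' : X₁, IsClosed ({x'} : Set X₁) → π x' ∈ (Y : Set X) →
              idealOrder (controlledTransform π (vanishingIdeal Y) J m) x' = m →
              (maximalIdeal (X₁.presheaf.stalk x')).spanFinrank = 3 →
              ∀ hr : IsRegularLocalRing (X₁.presheaf.stalk x'), 2 ≤ @stalkTau X₁ (controlledTransform π (vanishingIdeal Y) J m) x' hr m))) →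
      ∀ [IsIntegral ((V : X.Opens) : Scheme.{0})] [IsDominant V.ι],
      ∃ (V' : Scheme.{0}) (π : V' ⟶ V) (_ : IsIntegral V') (_ : IsDominant π) (K' : V'.IdealSheafData),
        IsCleanPermissibleSeq p π (J.comap V.ι) m K' (RatFn.functionFieldMap V.ι G) ∧ ∀ y, idealOrder K' y < m) :
    ∀ (p : ℕ), p.Prime → ∀ {X : Scheme.{0}} [IsIntegral X] [IsNoetherian X], CharP X.functionField p →
      ∀ (hX : Scheme.IsRegular X), Scheme.IsQuasiExcellent X → topologicalKrullDim X ≤ 3 →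
      ∀ (G : X.functionField), (∀ x : X, CleanRegAt p (algebraMap (X.presheaf.stalk x) X.functionField) G) →
      ∀ (J : X.IdealSheafData) {m : ℕ}, 1 ≤ m → (∀ z, idealOrder J z ≤ m) → (∀ z ∈ J.support, 1 < Order.coheight z) →
      ∀ (η : X), ¬ IsClosed ({η} : Set X) →
        Scheme.IsRegular (vanishingIdeal (⟨closure {η}, isClosed_closure⟩ : Closeds X)).subscheme →
        (∀ z : X, (m : ℕ∞) ≤ idealOrder J z → z ∈ closure ({η} : Set X)) →
        (∀ y ∈ closure ({η} : Set X), idealOrder J y = m) →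
      -- (τ1) some closed threefold point of order `m` has `τ = 1`
      ¬ (∀ x : X, IsClosed ({x} : Set X) → idealOrder J x = m → (maximalIdeal (X.presheaf.stalk x)).spanFinrank = 3 →
          ∀ hr : IsRegularLocalRing (X.presheaf.stalk x), 2 ≤ @stalkTau X J x hr m) →
      -- (vn′) NOT (clean-permissible along the curve AND no very near point over it)
      ¬ ((∀ y ∈ closure ({η} : Set X), CleanPermissibleAt p (algebraMap (X.presheaf.stalk y) X.functionField) G
            (stalkIdeal (vanishingIdeal (⟨closure {η}, isClosed_closure⟩ : Closeds X)) y)) ∧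
          (∀ (X₉ : Scheme.{0}) (π : X₉ ⟶ X), IsBlowup π (vanishingIdeal (⟨closure {η}, isClosed_closure⟩ : Closeds X)) →
            ∀ x' : X₉, IsClosed ({x'} : Set X₉) → π x' ∈ closure ({η} : Set X) →
              idealOrder (controlledTransform π (vanishingIdeal (⟨closure {η}, isClosed_closure⟩ : Closeds X)) J m) x' = m →
              (maximalIdeal (X₉.presheaf.stalk x')).spanFinrank = 3 →
              ∀ hr : IsRegularLocalRing (X₉.presheaf.stalk x'),
                2 ≤ @stalkTau X₉ (controlledTransform π (vanishingIdeal (⟨closure {η}, isClosed_closure⟩ : Closeds X)) J m) x' hr m)) →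
      -- (min) `λ` does not drop along any clean-permissible sequence reaching a curve situation
      (∀ (X₁ : Scheme.{0}) [IsIntegral X₁] (Φ : X₁ ⟶ X) [IsDominant Φ] (J₁ : X₁.IdealSheafData),
        IsCleanPermissibleSeq p Φ J m J₁ G → ∀ η₁ : X₁,
        ¬ IsClosed ({η₁} : Set X₁) →
        Scheme.IsRegular (vanishingIdeal (⟨closure {η₁}, isClosed_closure⟩ : Closeds X₁)).subscheme →
        (∀ z : X₁, (m : ℕ∞) ≤ idealOrder J₁ z → z ∈ closure ({η₁} : Set X₁)) →
        (∀ y ∈ closure ({η₁} : Set X₁), idealOrder J₁ y = m) →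
        (Module.length (X.presheaf.stalk η) (X.presheaf.stalk η ⧸ stalkIdeal J η)).toNat ≤
          (Module.length (X₁.presheaf.stalk η₁) (X₁.presheaf.stalk η₁ ⧸ stalkIdeal J₁ η₁)).toNat) →
      ∃ (X' : Scheme.{0}) (π : X' ⟶ X) (_ : IsIntegral X') (_ : IsDominant π) (J' : X'.IdealSheafData),
        IsCleanPermissibleSeq p π J m J' G ∧ ∀ x, idealOrder J' x < m := by
  intro p hp X _ _ hchar hX hqe hX3 G hG J m hm hle hcodim η hηcl hYreg hstr hord hτ hvn _
  haveI := hchar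
  have hcoh3 : ∀ z : X, Order.coheight z ≤ 3 := (topologicalKrullDim_le_iff_forall_coheight_le X 3).mp hX3
  have hηY : η ∈ closure ({η} : Set X) := subset_closure rfl
  have hsuppη : η ∈ J.support := by
    rw [← one_le_idealOrder_iff, hord η hηY]
    exact_mod_cast hm
  have hcoh : Order.coheight η = 2 := coheight_eq_two_of_not_isClosed hcoh3 (hcodim η hsuppη) hηcl
  have hYirr : IsIrreducible (((⟨closure {η}, isClosed_closure⟩ : Closeds X)) : Set X) := isIrreducible_singleton.closure
  -- the open `⊤`
  haveI hne : Nonempty ((⊤ : X.Opens) : Scheme.{0}) := ⟨⟨η, trivial⟩⟩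
  haveI : IsIntegral ((⊤ : X.Opens) : Scheme.{0}) := isIntegral_of_isOpenImmersion (⊤ : X.Opens).ι
  haveI : IsDominant (⊤ : X.Opens).ι := isDominant_of_isOpenImmersion (⊤ : X.Opens).ι
  -- the regular pair of parameters along the curve
  have hrsop : ∀ y ∈ (((⟨closure {η}, isClosed_closure⟩ : Closeds X)) : Set X), haveI := hX y;
      ∃ c : Fin 2 → X.presheaf.stalk y, IsRsopPart c ∧
        Ideal.span (Set.range c) = stalkIdeal (vanishingIdeal (⟨closure {η}, isClosed_closure⟩ : Closeds X)) y :=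
    fun y hy => exists_rsopPair_of_mem_curve hX hcoh3 hYreg rfl hcoh hy
  -- a `τ = 1` point of order `m` lies ON the curve
  have hτ' : ¬ ∀ y ∈ (((⟨closure {η}, isClosed_closure⟩ : Closeds X)) : Set X), IsClosed ({y} : Set X) →
      haveI := hX y; 2 ≤ stalkTau J y m := by
    intro hall
    apply hτ
    intro x hxcl hordx _ hr
    have hxY : x ∈ closure ({η} : Set X) := hstr x (by rw [hordx])
    exact hall x hxY hxcl
  exact exists_isCleanPermissibleSeq_lt_of_top J m G
    (hcurveTauOneVN p hp hchar hX hqe hX3 G hG J hm hle hcodim ⊤ ⟨closure {η}, isClosed_closure⟩ hYreg hYirr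
      (fun x _ => TopologicalSpace.Opens.mem_top x) (fun z hz => Or.inl (hstr z hz)) hord hrsop hτ' hvn)

/-! ## §2 (R3ᵐⁱⁿ′) ⟸ (R3ᵐⁱⁿ) -/

set_option maxHeartbeats 800000 in
-- long binder lists
/-- **(R3ᵐⁱⁿ′) ⟸ (R3ᵐⁱⁿ)** (drop the inserted hypothesis «no near curve»).  With ✓ `curveTauOneVN_of_curveMin`, ✓ `curveMin_of_curveMinNoGamma` and
`curveMin_of_curveTauOneVN` above: (R3ᵛⁿ′) ⟺ (R3ᵐⁱⁿ) ⟺ (R3ᵐⁱⁿ′). [cite: CossartPiltant2008, Prop. 4.4 (proof, p. 10)] -/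
theorem curveMinNoGamma_of_curveMin
    (hcurveMin : ∀ (p : ℕ), p.Prime → ∀ {X : Scheme.{0}} [IsIntegral X] [IsNoetherian X], CharP X.functionField p →
      ∀ (hX : Scheme.IsRegular X), Scheme.IsQuasiExcellent X → topologicalKrullDim X ≤ 3 →
      ∀ (G : X.functionField), (∀ x : X, CleanRegAt p (algebraMap (X.presheaf.stalk x) X.functionField) G) →
      ∀ (J : X.IdealSheafData) {m : ℕ}, 1 ≤ m → (∀ z, idealOrder J z ≤ m) → (∀ z ∈ J.support, 1 < Order.coheight z) →
      ∀ (η : X), ¬ IsClosed ({η} : Set X) →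
        Scheme.IsRegular (vanishingIdeal (⟨closure {η}, isClosed_closure⟩ : Closeds X)).subscheme →
        (∀ z : X, (m : ℕ∞) ≤ idealOrder J z → z ∈ closure ({η} : Set X)) →
        (∀ y ∈ closure ({η} : Set X), idealOrder J y = m) →
      -- (τ1) some closed threefold point of order `m` has `τ = 1`
      ¬ (∀ x : X, IsClosed ({x} : Set X) → idealOrder J x = m → (maximalIdeal (X.presheaf.stalk x)).spanFinrank = 3 →
          ∀ hr : IsRegularLocalRing (X.presheaf.stalk x), 2 ≤ @stalkTau X J x hr m) →
      -- (vn′) NOT (clean-permissible along the curve AND no very near point over it)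
      ¬ ((∀ y ∈ closure ({η} : Set X), CleanPermissibleAt p (algebraMap (X.presheaf.stalk y) X.functionField) G
            (stalkIdeal (vanishingIdeal (⟨closure {η}, isClosed_closure⟩ : Closeds X)) y)) ∧
          (∀ (X₉ : Scheme.{0}) (π : X₉ ⟶ X), IsBlowup π (vanishingIdeal (⟨closure {η}, isClosed_closure⟩ : Closeds X)) →
            ∀ x' : X₉, IsClosed ({x'} : Set X₉) → π x' ∈ closure ({η} : Set X) →
              idealOrder (controlledTransform π (vanishingIdeal (⟨closure {η}, isClosed_closure⟩ : Closeds X)) J m) x' = m →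
              (maximalIdeal (X₉.presheaf.stalk x')).spanFinrank = 3 →
              ∀ hr : IsRegularLocalRing (X₉.presheaf.stalk x'),
                2 ≤ @stalkTau X₉ (controlledTransform π (vanishingIdeal (⟨closure {η}, isClosed_closure⟩ : Closeds X)) J m) x' hr m)) →
      -- (min) `λ` does not drop along any clean-permissible sequence reaching a curve situation
      (∀ (X₁ : Scheme.{0}) [IsIntegral X₁] (Φ : X₁ ⟶ X) [IsDominant Φ] (J₁ : X₁.IdealSheafData),
        IsCleanPermissibleSeq p Φ J m J₁ G → ∀ η₁ : X₁,
        ¬ IsClosed ({η₁} : Set X₁) →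
        Scheme.IsRegular (vanishingIdeal (⟨closure {η₁}, isClosed_closure⟩ : Closeds X₁)).subscheme →
        (∀ z : X₁, (m : ℕ∞) ≤ idealOrder J₁ z → z ∈ closure ({η₁} : Set X₁)) →
        (∀ y ∈ closure ({η₁} : Set X₁), idealOrder J₁ y = m) →
        (Module.length (X.presheaf.stalk η) (X.presheaf.stalk η ⧸ stalkIdeal J η)).toNat ≤
          (Module.length (X₁.presheaf.stalk η₁) (X₁.presheaf.stalk η₁ ⧸ stalkIdeal J₁ η₁)).toNat) →
      ∃ (X' : Scheme.{0}) (π : X' ⟶ X) (_ : IsIntegral X') (_ : IsDominant π) (J' : X'.IdealSheafData),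
        IsCleanPermissibleSeq p π J m J' G ∧ ∀ x, idealOrder J' x < m) :
    ∀ (p : ℕ), p.Prime → ∀ {X : Scheme.{0}} [IsIntegral X] [IsNoetherian X], CharP X.functionField p →
      ∀ (hX : Scheme.IsRegular X), Scheme.IsQuasiExcellent X → topologicalKrullDim X ≤ 3 →
      ∀ (G : X.functionField), (∀ x : X, CleanRegAt p (algebraMap (X.presheaf.stalk x) X.functionField) G) →
      ∀ (J : X.IdealSheafData) {m : ℕ}, 1 ≤ m → (∀ z, idealOrder J z ≤ m) → (∀ z ∈ J.support, 1 < Order.coheight z) →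
      ∀ (η : X), ¬ IsClosed ({η} : Set X) →
        Scheme.IsRegular (vanishingIdeal (⟨closure {η}, isClosed_closure⟩ : Closeds X)).subscheme →
        (∀ z : X, (m : ℕ∞) ≤ idealOrder J z → z ∈ closure ({η} : Set X)) →
        (∀ y ∈ closure ({η} : Set X), idealOrder J y = m) →
      -- (τ1) some closed threefold point of order `m` has `τ = 1`
      ¬ (∀ x : X, IsClosed ({x} : Set X) → idealOrder J x = m → (maximalIdeal (X.presheaf.stalk x)).spanFinrank = 3 →
          ∀ hr : IsRegularLocalRing (X.presheaf.stalk x), 2 ≤ @stalkTau X J x hr m) →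
      -- (vn′) NOT (clean-permissible along the curve AND no very near point over it)
      ¬ ((∀ y ∈ closure ({η} : Set X), CleanPermissibleAt p (algebraMap (X.presheaf.stalk y) X.functionField) G
            (stalkIdeal (vanishingIdeal (⟨closure {η}, isClosed_closure⟩ : Closeds X)) y)) ∧
          (∀ (X₉ : Scheme.{0}) (π : X₉ ⟶ X), IsBlowup π (vanishingIdeal (⟨closure {η}, isClosed_closure⟩ : Closeds X)) →
            ∀ x' : X₉, IsClosed ({x'} : Set X₉) → π x' ∈ closure ({η} : Set X) →
              idealOrder (controlledTransform π (vanishingIdeal (⟨closure {η}, isClosed_closure⟩ : Closeds X)) J m) x' = m →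
              (maximalIdeal (X₉.presheaf.stalk x')).spanFinrank = 3 →
              ∀ hr : IsRegularLocalRing (X₉.presheaf.stalk x'),
                2 ≤ @stalkTau X₉ (controlledTransform π (vanishingIdeal (⟨closure {η}, isClosed_closure⟩ : Closeds X)) J m) x' hr m)) →
      -- (noΓ′) NOT (clean-permissible along the curve AND a near point over its generic point after blowing it up)
      ¬ ((∀ y ∈ closure ({η} : Set X), CleanPermissibleAt p (algebraMap (X.presheaf.stalk y) X.functionField) G
            (stalkIdeal (vanishingIdeal (⟨closure {η}, isClosed_closure⟩ : Closeds X)) y)) ∧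
          ∃ (X₉ : Scheme.{0}) (π : X₉ ⟶ X) (_ : IsBlowup π (vanishingIdeal (⟨closure {η}, isClosed_closure⟩ : Closeds X))) (η' : X₉),
            π η' = η ∧ idealOrder (controlledTransform π (vanishingIdeal (⟨closure {η}, isClosed_closure⟩ : Closeds X)) J m) η' = m) →
      -- (min) `λ` does not drop along any clean-permissible sequence reaching a curve situation
      (∀ (X₁ : Scheme.{0}) [IsIntegral X₁] (Φ : X₁ ⟶ X) [IsDominant Φ] (J₁ : X₁.IdealSheafData),
        IsCleanPermissibleSeq p Φ J m J₁ G → ∀ η₁ : X₁,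
        ¬ IsClosed ({η₁} : Set X₁) →
        Scheme.IsRegular (vanishingIdeal (⟨closure {η₁}, isClosed_closure⟩ : Closeds X₁)).subscheme →
        (∀ z : X₁, (m : ℕ∞) ≤ idealOrder J₁ z → z ∈ closure ({η₁} : Set X₁)) →
        (∀ y ∈ closure ({η₁} : Set X₁), idealOrder J₁ y = m) →
        (Module.length (X.presheaf.stalk η) (X.presheaf.stalk η ⧸ stalkIdeal J η)).toNat ≤
          (Module.length (X₁.presheaf.stalk η₁) (X₁.presheaf.stalk η₁ ⧸ stalkIdeal J₁ η₁)).toNat) →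
      ∃ (X' : Scheme.{0}) (π : X' ⟶ X) (_ : IsIntegral X') (_ : IsDominant π) (J' : X'.IdealSheafData),
        IsCleanPermissibleSeq p π J m J' G ∧ ∀ x, idealOrder J' x < m := by
  intro p hp X _ _ hchar hX hqe hX3 G hG J m hm hle hcodim η hηcl hYreg hstr hord hτ hvn _ hmin
  exact hcurveMin p hp hchar hX hqe hX3 G hG J hm hle hcodim η hηcl hYreg hstr hord hτ hvn hmin

end Summit.ResolutionOfSingularities.ResolutionOfSingularities.Theorems.RadicialJung.CleanModels

end
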